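import Summits.HodgeConjecture.HodgeConjecture.Theorems.R90S8ResGMidResidueClassNeZeroU3      -- ★ p862719 (this seat): `resGMidBlock_ne_bot_of_poleLetter`, `exists_forall_norm_sub_mul_le_near_at`, `exists_puncturedBall_subset_of_finset`; brings ★ K2E1-p11 G-DEFS, ★ K2E1-p03 residue file
import Summits.HodgeConjecture.HodgeConjecture.Theorems.K2E1ChiScatteringMiddlePoleU3          -- ★ F5 (R90-C133-p02): `residue_at_threeHalves_ne_zero_of_lHalfNeZero_cm_three`; brings ★ `LHalfNeZero`
import HarnessLib

/-!
# R90-TF · S8 «ContSpec-n½» — `R90S8ResGMidBlockNeBotOfLettersU3`: THE (V) ASSEMBLY SEAM — `L(½, ξ·bcη⁻¹·μω) ≠ 0 → resGMidBlock ξ μω ≠ ⊥` OVER THE HONEST LETTERS OF THE ROAD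

Cell `hodgecm-mathlib`, crux H413 (`stmt-HodgeConjecture-24833`, lane `--supports … --as helper`), route of record `HCCMUnconditional`; R90-TF section S8, deal S8-R71 (R90-CS-plan (g2))
«(V) SEAM → K2E2-p12 (g8)»: the conclusion is socket (V)'s bytes `LHalfNeZero (ξ.bcη⁻¹ * μω) → (resGMidBlock L μ ξ μω).toSubmodule ≠ ⊥` (B ED. 5, S8-R68), HYPOTHESIS-FIRST over the
letters that pay it; consumer: R90-CS-typ2's B ED. 6 (shrinks socket (V) to these letters).  THEOREMS ONLY (no `def`, no `instance`, no notation, no named-fact hypothesis, no `sorry`;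
default heartbeats); count-neutral.

THE MATHEMATICS ([Rogawski1990, §13.9 (ii) p. 229, Thm. 13.3.6 (b) p. 202]; [MoeglinWaldspurger1995, II.1.7, IV.1.11]).  Three inputs: (iii) the SCALAR letter — ★ F5
`residue_at_threeHalves_ne_zero_of_lHalfNeZero_cm_three`: under its visible letters (`hsrc`, `A(3/2) ≠ 0`, `η = 1`, `φ ≠ 1`) `L(½, φ) ≠ 0` makes the residue `ρ` of the scattering
coordinate at the middle pole `z₀ = 3/2` non-zero; (ii) the CONSTANT-TERM letter — the residue of the constant term of the continued family is `ρ·Ψ(g)` (the scattering term's shape;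
visible as `hCT`, `hΨ : Ψ(g₀) ≠ 0`); and two facts PROVED here: the constant term COMMUTES with the residue limit (§1 `tendsto_sub_mul_borelConstantTerm`: dominated convergence on
the compact-closure domain `𝓕`, the uniform bound near the pole being ★ `exists_forall_norm_sub_mul_le_near_at`) and «a non-zero constant term forces a non-zero value» (§1
`exists_apply_ne_zero_of_borelConstantTerm_ne_zero`: the constant term is an integral of `r`); (i) the GENERATOR data of ★ `resGMidAtomGen` with the three LAYER-2 letters and an `L²`
residue class `f` — ★ `resGMidBlock_ne_bot_of_poleLetter` turns ONE non-zero residue value into `resGMidBlock ≠ ⊥`.  Chain: `L(½) ≠ 0 ⇒ ρ ≠ 0 ⇒ r_B(g₀) = ρ·Ψ(g₀) ≠ 0 ⇒ r(g₁) ≠ 0 ⇒ [r] ≠ 0 ⇒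
resGMidBlock ≠ ⊥`.
* §1 `exists_apply_ne_zero_of_borelConstantTerm_ne_zero`, **`tendsto_sub_mul_borelConstantTerm`** (any pole `z₀`, any `quasiSplit F E c N`).
* §2 **`resGMidBlock_ne_bot_of_letters`** — THE (V) SEAM on Mok's carrier `quasiSplit L⁺ L c 3`.
HONEST LABEL: HC_CM is proved only modulo the 7 printed citations (2 remaining named inputs: hLiu418 = `stmt-HodgeConjecture-24832`, h413 = `stmt-HodgeConjecture-24833`) until rung 0
closes; count-neutral helper; (V) stays a socket in B ED. 5 — this seam only names what pays it: visible letters = F5's (`hsrc`, `A (3/2) ≠ 0`, `η = 1`, `φ ≠ 1`), the scattering-residue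
shape `hCT`∕`hΨ` of the constant term (G9₃), the three LAYER-2 letters of the family, and the existence of the `L²` residue class `f` ([MW95 I.4.11]).

## References
* [Rogawski1990] J. D. Rogawski, *Automorphic Representations of Unitary Groups in Three Variables* (1990), §13.9 (ii) p. 229, Thm. 13.3.6 (b) p. 202.
* [MoeglinWaldspurger1995] C. Mœglin, J.-L. Waldspurger, *Spectral Decomposition and Eisenstein Series* (1995), II.1.7 (constant terms), IV.1.11 (residues), I.4.11.
-/

set_option autoImplicit false
-- the mandated namespace repeats the single-problem summit's segment (`HodgeConjecture.HodgeConjecture`)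
set_option linter.dupNamespace false

noncomputable section

open MeasureTheory Measure NumberField IsDedekindDomain Set Filter Topology Metric
open scoped ENNReal NNReal
open Literature.NumberTheory.Automorphic Literature.NumberTheory.Automorphic.UnitaryGroup Literature.NumberTheory.LFunctions Literature.NumberTheory.GaloisRepresentations AdelicGroupData
open Literature.NumberTheory.Rogawski1990
open Summit.HodgeConjecture.HodgeConjecture.Cruxes.H413.K2E1BorelEisensteinU
open Summit.HodgeConjecture.HodgeConjecture.Cruxes.H413.K2E1ChiSectionSpaceU3PairDefs
open Summit.HodgeConjecture.HodgeConjecture.Cruxes.H413.K2E1HeckeLHalfNeZeroDefs (LHalfNeZero)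
open Summit.HodgeConjecture.HodgeConjecture.Cruxes.H413.K2E1ChiScatteringMiddlePoleU3 (residue_at_threeHalves_ne_zero_of_lHalfNeZero_cm_three)

namespace Summit.HodgeConjecture.HodgeConjecture.R90.S8

/-! ## §1 The constant term of the residue: it commutes with the residue limit, and a non-zero constant term forces a non-zero value -/

section ConstantTerm

variable {F E : Type} [Field F] [NumberField F] [Field E] [NumberField E] [Algebra F E] {c : E ≃ₐ[F] E} {N : ℕ}
variable [MeasurableSpace (quasiSplit F E c N).Adelic] [BorelSpace (quasiSplit F E c N).Adelic]

omit [MeasurableSpace (quasiSplit F E c N).Adelic] [BorelSpace (quasiSplit F E c N).Adelic] in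
/-- **A NON-ZERO CONSTANT TERM FORCES A NON-ZERO VALUE**: `r_B(g) = (ν 𝓕)⁻¹ ∫_𝓕 r(u·g) dν(u) ≠ 0 ⇒ ∃ x, r x ≠ 0` (the constant term of `0` is `0`). [cite: MoeglinWaldspurger1995, II.1.7] -/
theorem exists_apply_ne_zero_of_borelConstantTerm_ne_zero [MeasurableSpace ↥(adelicUnipotent F E c N)] (ν : Measure ↥(adelicUnipotent F E c N))
    (𝓕 : Set ↥(adelicUnipotent F E c N)) {r : (quasiSplit F E c N).Adelic → ℂ} {g : (quasiSplit F E c N).Adelic} (h : borelConstantTerm ν 𝓕 r g ≠ 0) :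
    ∃ x, r x ≠ 0 := by
  by_contra hr
  have h0 : r = 0 := funext fun x => not_not.1 (not_exists.1 hr x)
  exact h (by rw [h0, borelConstantTerm_zero])

/-- **THE CONSTANT TERM COMMUTES WITH THE RESIDUE LIMIT** at any pole `z₀`: for the continued family `Ẽ` with (E1) holomorphy, (E4) continuity and (E2-bd) local bounds on `D ⊇ B(z₀,ρ)∖{z₀}`
and a pole letter `Fp` at `z₀`, `(z − z₀)·Ẽ(z)_B(g) → (x ↦ Fp x z₀)_B(g)` along `𝓝[≠] z₀` — dominated convergence on the fundamental domain `𝓕` (compact closure, finite Haar mass), the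
uniform bound near the pole on the compact `closure(𝓕)·g` being ★ `exists_forall_norm_sub_mul_le_near_at`. [cite: MoeglinWaldspurger1995, II.1.7, IV.1.11] -/
theorem tendsto_sub_mul_borelConstantTerm (ν : Measure ↥(adelicUnipotent F E c N)) [ν.IsHaarMeasure] {𝓕 : Set ↥(adelicUnipotent F E c N)}
    (h𝓕N : IsFundamentalDomain ↥(rationalUnipotent F E c N) 𝓕 ν) (h𝓕c : IsCompact (closure 𝓕))
    (Ec : ℂ → (quasiSplit F E c N).Adelic → ℂ) {D : Set ℂ} (hDo : IsOpen D) {z₀ : ℂ} {ρ : ℝ} (hρ : 0 < ρ)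
    (hρD : ∀ z : ℂ, z ≠ z₀ → dist z z₀ < ρ → z ∈ D) (hEd : ∀ g, DifferentiableOn ℂ (fun z => Ec z g) D) (hE4 : ∀ z ∈ D, Continuous (Ec z))
    (hEbd : ∀ z₁ ∈ D, ∀ K : Set (quasiSplit F E c N).Adelic, IsCompact K → ∃ V ∈ 𝓝 z₁, ∃ M : ℝ, ∀ z ∈ V, ∀ g ∈ K, ‖Ec z g‖ ≤ M)
    (Fp : (quasiSplit F E c N).Adelic → ℂ → ℂ) (hF : ∀ g, AnalyticAt ℂ (Fp g) z₀) (hFE : ∀ g, Fp g =ᶠ[𝓝[≠] z₀] fun z => (z - z₀) * Ec z g)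
    (g : (quasiSplit F E c N).Adelic) :
    Tendsto (fun z : ℂ => (z - z₀) * borelConstantTerm ν 𝓕 (Ec z) g) (𝓝[≠] z₀) (𝓝 (borelConstantTerm ν 𝓕 (fun x => Fp x z₀) g)) := by
  -- the compact `closure(𝓕)·g` and the uniform bound near the pole
  have hK : IsCompact ((fun u : ↥(adelicUnipotent F E c N) => (u : (quasiSplit F E c N).Adelic) * g) '' closure 𝓕) :=
    h𝓕c.image (continuous_subtype_val.mul continuous_const)
  obtain ⟨M, -, hM, -⟩ := exists_forall_norm_sub_mul_le_near_at Ec hDo hρ hρD hEd hEbd Fp hF hFE hK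
  have h𝓕top : ν 𝓕 < ∞ := (measure_mono subset_closure).trans_lt h𝓕c.measure_lt_top
  haveI : IsFiniteMeasure (ν.restrict 𝓕) := ⟨by rwa [Measure.restrict_apply_univ]⟩
  have hnear : ∀ᶠ z in 𝓝[≠] z₀, z ≠ z₀ ∧ dist z z₀ ≤ ρ / 2 ∧ z ∈ D := by
    filter_upwards [inter_mem_nhdsWithin _ (closedBall_mem_nhds z₀ (half_pos hρ))] with z hz
    exact ⟨hz.1, mem_closedBall.1 hz.2, hρD z hz.1 ((mem_closedBall.1 hz.2).trans_lt (half_lt_self hρ))⟩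
  -- dominated convergence on `𝓕`
  have hint : Tendsto (fun z : ℂ => ∫ u in 𝓕, (z - z₀) * Ec z ((u : (quasiSplit F E c N).Adelic) * g) ∂ν) (𝓝[≠] z₀)
      (𝓝 (∫ u in 𝓕, Fp ((u : (quasiSplit F E c N).Adelic) * g) z₀ ∂ν)) := by
    refine tendsto_integral_filter_of_dominated_convergence (fun _ => M) ?_ ?_ (integrable_const M) ?_
    · filter_upwards [hnear] with z hz
      exact (continuous_const.mul ((hE4 z hz.2.2).comp (continuous_subtype_val.mul continuous_const))).aestronglyMeasurable
    · filter_upwards [hnear] with z hz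
      exact (ae_restrict_mem₀ h𝓕N.nullMeasurableSet).mono fun u hu => hM _ ⟨u, subset_closure hu, rfl⟩ z hz.1 hz.2.1
    · exact Eventually.of_forall fun u => (tendsto_nhdsWithin_of_tendsto_nhds (hF _).continuousAt.tendsto).congr' (hFE _)
  have heq : (fun z : ℂ => (z - z₀) * borelConstantTerm ν 𝓕 (Ec z) g) =
      fun z => ((ν 𝓕).toReal⁻¹ : ℝ) • ∫ u in 𝓕, (z - z₀) * Ec z ((u : (quasiSplit F E c N).Adelic) * g) ∂ν := by
    funext z
    rw [borelConstantTerm_def, integral_const_mul, Complex.real_smul, Complex.real_smul, mul_left_comm]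
  rw [heq, borelConstantTerm_def]
  exact hint.const_smul _

end ConstantTerm

/-! ## §2 THE (V) SEAM on Mok's carrier `quasiSplit L⁺ L c 3` -/

section Seam

variable (L : Type) [Field L] [NumberField L] [IsCMField L]
variable [MeasurableSpace (quasiSplit (↥(maximalRealSubfield L)) L (IsCMField.complexConj L) 3).Adelic] [BorelSpace (quasiSplit (↥(maximalRealSubfield L)) L (IsCMField.complexConj L) 3).Adelic]
  (μ : Measure (quasiSplit (↥(maximalRealSubfield L)) L (IsCMField.complexConj L) 3).automorphicQuotient) [(quasiSplit (↥(maximalRealSubfield L)) L (IsCMField.complexConj L) 3).IsAutomorphicMeasure μ]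

/-- **THE (V) ASSEMBLY SEAM — `L(½, ξ·bcη⁻¹·μω) ≠ 0 → resGMidBlock ξ μω ≠ ⊥` OVER THE LETTERS OF THE ROAD.**  Binders: (i) the generator data of ★ `resGMidAtomGen` at a level `(K′, ω)`
(continuous pair-section `φ` of the `φ_ξ`-block, its inline-continued family `Ec` on `{1 < Re} ∖ Sp`, pole letter `Fp` at `3/2`) + the three LAYER-2 letters of the same family there
((E4), (E2-bd), `G(F)`-invariance) + an `L²` class `f =ᵐ x ↦ Fp((out x)⁻¹)(3/2)`; (ii) the fundamental-domain data `(ν, 𝓕)` of the constant term and the SCATTERING-RESIDUE SHAPE of the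
constant term at the middle pole, `(z − 3/2)·Ẽ(z)_B(g) → ρ·Ψ(g)` with `Ψ(g₀) ≠ 0`; (iii) ★ F5's letters VERBATIM at `φ := ξ.bcη⁻¹ * μω` (`hsrc`, `A (3/2) ≠ 0`, `η = 1`, `φ ≠ 1`, the
residue-limit `(z − 3/2)·qc z → ρ`).  Then `LHalfNeZero (ξ.bcη⁻¹ * μω) → (resGMidBlock L μ ξ μω).toSubmodule ≠ ⊥`: ★ F5 gives `ρ ≠ 0`; §1 gives `r_B(g₀) = ρ·Ψ(g₀) ≠ 0` hence
`r(g₁) ≠ 0`; ★ `resGMidBlock_ne_bot_of_poleLetter` concludes. [cite: Rogawski1990, §13.9 (ii) p. 229] [cite: Rogawski1990, Thm. 13.3.6 (b) p. 202] [cite: MoeglinWaldspurger1995, IV.1.11] -/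
theorem resGMidBlock_ne_bot_of_letters (ξ : OneDimAutRepH L) (μω : HeckeCharacter L)
    (K' : Subgroup (quasiSplit (↥(maximalRealSubfield L)) L (IsCMField.complexConj L) 3).Adelic) (ω : ↥K' →* ℂ)
    -- (i) generator data (★ `resGMidAtomGen` clauses) + LAYER-2 letters + the `L²` residue class
    (φ : (quasiSplit (↥(maximalRealSubfield L)) L (IsCMField.complexConj L) 3).Adelic → ℂ) (hφ : φ ∈ chiSectionSpacePair (ξ.bcη⁻¹ * ξ.bcψ⁻¹ * μω) ξ.ψ K' (ω : ↥K' → ℂ)) (hφc : Continuous φ)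
    (Ec : ℂ → (quasiSplit (↥(maximalRealSubfield L)) L (IsCMField.complexConj L) 3).Adelic → ℂ) (Sp : Finset ℂ) (hSp : ∀ s ∈ Sp, s.im = 0 ∧ 1 < s.re ∧ s.re ≤ 2)
    (hEd : ∀ g, DifferentiableOn ℂ (fun z => Ec z g) ({z : ℂ | 1 < z.re} \ (↑Sp : Set ℂ)))
    (hE2 : ∀ z : ℂ, 2 < z.re → Ec z = eisensteinSeriesU (flatSectionU φ z))
    (Fp : (quasiSplit (↥(maximalRealSubfield L)) L (IsCMField.complexConj L) 3).Adelic → ℂ → ℂ) (hF : ∀ g, AnalyticAt ℂ (Fp g) ((3 : ℂ) / 2))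
    (hFE : ∀ g, Fp g =ᶠ[𝓝[≠] ((3 : ℂ) / 2)] fun z => (z - (3 : ℂ) / 2) * Ec z g)
    (hE4 : ∀ z ∈ ({z : ℂ | 1 < z.re} \ (↑Sp : Set ℂ)), Continuous (Ec z))
    (hEbd : ∀ z₁ ∈ ({z : ℂ | 1 < z.re} \ (↑Sp : Set ℂ)), ∀ K : Set (quasiSplit (↥(maximalRealSubfield L)) L (IsCMField.complexConj L) 3).Adelic, IsCompact K → ∃ V ∈ 𝓝 z₁, ∃ M : ℝ, ∀ z ∈ V, ∀ g ∈ K, ‖Ec z g‖ ≤ M)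
    (hEcinv : ∀ z ∈ ({z : ℂ | 1 < z.re} \ (↑Sp : Set ℂ)), ∀ (γ : (quasiSplit (↥(maximalRealSubfield L)) L (IsCMField.complexConj L) 3).arithmeticSubgroup) (x : (quasiSplit (↥(maximalRealSubfield L)) L (IsCMField.complexConj L) 3).Adelic), Ec z ((γ : (quasiSplit (↥(maximalRealSubfield L)) L (IsCMField.complexConj L) 3).Adelic) * x) = Ec z x)
    (f : (quasiSplit (↥(maximalRealSubfield L)) L (IsCMField.complexConj L) 3).L2 μ) (hf : (f : (quasiSplit (↥(maximalRealSubfield L)) L (IsCMField.complexConj L) 3).automorphicQuotient → ℂ) =ᵐ[μ] fun x => Fp (Quotient.out (x : (quasiSplit (↥(maximalRealSubfield L)) L (IsCMField.complexConj L) 3).Adelic ⧸ (quasiSplit (↥(maximalRealSubfield L)) L (IsCMField.complexConj L) 3).quotientSubgroup))⁻¹ ((3 : ℂ) / 2))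
    -- (ii) the constant term: its domain data and the scattering-residue shape at the middle pole
    (ν : Measure ↥(adelicUnipotent (↥(maximalRealSubfield L)) L (IsCMField.complexConj L) 3)) [ν.IsHaarMeasure]
    {𝓕 : Set ↥(adelicUnipotent (↥(maximalRealSubfield L)) L (IsCMField.complexConj L) 3)}
    (h𝓕N : IsFundamentalDomain ↥(rationalUnipotent (↥(maximalRealSubfield L)) L (IsCMField.complexConj L) 3) 𝓕 ν) (h𝓕c : IsCompact (closure 𝓕))
    (Ψ : (quasiSplit (↥(maximalRealSubfield L)) L (IsCMField.complexConj L) 3).Adelic → ℂ) {ρ : ℂ}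
    (hCT : ∀ g, Tendsto (fun z : ℂ => (z - (3 : ℂ) / 2) * borelConstantTerm ν 𝓕 (Ec z) g) (𝓝[≠] ((3 : ℂ) / 2)) (𝓝 (ρ * Ψ g)))
    {g₀ : (quasiSplit (↥(maximalRealSubfield L)) L (IsCMField.complexConj L) 3).Adelic} (hΨ : Ψ g₀ ≠ 0)
    -- (iii) ★ F5's letters at `φ := ξ.bcη⁻¹ * μω`
    {η : HeckeCharacter ↥(maximalRealSubfield L)} {S : Set (HeightOneSpectrum (𝓞 L))} {T : Set (HeightOneSpectrum (𝓞 ↥(maximalRealSubfield L)))}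
    (hφu : (ξ.bcη⁻¹ * μω).IsUnitary) (hφA : ∀ t : ℝ≥0ˣ, (ξ.bcη⁻¹ * μω) (posRealIdele L t) = 1) (hS : S.Finite) (hurφ : ∀ w ∉ S, (ξ.bcη⁻¹ * μω).IsUnramifiedAt w)
    (hη : η.IsUnitary) (hηA : ∀ t : ℝ≥0ˣ, η (posRealIdele ↥(maximalRealSubfield L) t) = 1) (hT : T.Finite) (hurη : ∀ v ∉ T, η.IsUnramifiedAt v)
    (q qc : ℂ → ℂ) {P : Set ℂ} (hqcq : ∀ z : ℂ, 2 < z.re → qc z = q z) (hPcd : ∀ z₀ : ℂ, ∀ᶠ s in 𝓝[≠] z₀, s ∉ P) (hqa : ∀ z : ℂ, z ∉ P → AnalyticAt ℂ qc z)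
    (A : ℂ → ℂ) (hA : DifferentiableOn ℂ A {z : ℂ | 1 < z.re})
    (hsrc : ∀ z : ℂ, 2 < z.re → q z = A z *
          ((partialStandardL S (fun w => {(ξ.bcη⁻¹ * μω).valueAtUniformizer w}) (z - 1) * partialStandardL T (fun v => {η.valueAtUniformizer v}) (2 * z - 2)) /
            (partialStandardL S (fun w => {(ξ.bcη⁻¹ * μω).valueAtUniformizer w}) z * partialStandardL T (fun v => {η.valueAtUniformizer v}) (2 * z - 1))))
    (hη1 : η = 1) (hφ1 : ξ.bcη⁻¹ * μω ≠ 1) (hA32 : A (3 / 2) ≠ 0)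
    (hρ : Tendsto (fun z : ℂ => (z - 3 / 2) * qc z) (𝓝[≠] (3 / 2)) (𝓝 ρ)) :
    LHalfNeZero (ξ.bcη⁻¹ * μω) → (resGMidBlock L μ ξ μω).toSubmodule ≠ ⊥ := fun hL => by
  -- (iii) the scalar residue is non-zero
  have hρ0 : ρ ≠ 0 :=
    residue_at_threeHalves_ne_zero_of_lHalfNeZero_cm_three L hφu hφA hS hurφ hη hηA hT hurη q qc hqcq hPcd hqa A hA hsrc hη1 hφ1 hL hA32 hρ
  -- (ii) the constant term of the residue at `g₀` is `ρ·Ψ(g₀) ≠ 0`, so the residue function is non-zero somewhere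
  obtain ⟨ρ', hρ', hρ'D⟩ := exists_puncturedBall_subset_of_finset Sp
  have hDo : IsOpen ({z : ℂ | 1 < z.re} \ (↑Sp : Set ℂ)) := (isOpen_lt continuous_const Complex.continuous_re).sdiff Sp.finite_toSet.isClosed
  have hCTr := tendsto_sub_mul_borelConstantTerm ν h𝓕N h𝓕c Ec hDo hρ' hρ'D hEd hE4 hEbd Fp hF hFE g₀
  have hval : borelConstantTerm ν 𝓕 (fun x => Fp x ((3 : ℂ) / 2)) g₀ = ρ * Ψ g₀ := tendsto_nhds_unique hCTr (hCT g₀)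
  have hne : borelConstantTerm ν 𝓕 (fun x => Fp x ((3 : ℂ) / 2)) g₀ ≠ 0 := by
    rw [hval]
    exact mul_ne_zero hρ0 hΨ
  obtain ⟨g₁, hg₁⟩ := exists_apply_ne_zero_of_borelConstantTerm_ne_zero ν 𝓕 hne
  -- (i) a non-zero residue value gives a non-zero residue class in the middle atom
  exact (resGMidBlock_ne_bot_of_poleLetter L μ ξ μω K' ω φ hφ hφc Ec Sp hSp hEd hE2 Fp hF hFE hE4 hEbd hEcinv hg₁ f hf).2.2.2

end Seam

end Summit.HodgeConjecture.HodgeConjecture.R90.S8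

end
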